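import Literature.Computability.AlgebraicComplexity.IK2020TableauLiftingRightPart
import Literature.NumberTheory.DiophantineGeometry.SchurWeylHighestWeightProofs
import HarnessLib

/-!
# Words of shape `λ` as column tableaux: the plumbing between the tensor-word model of `{λ}`
# and `IK2020.ColTableau` (programme: discharge of `IK2020_thm_9_1_orbitFunctions`)

Typed-and-proved literature (cell `val-lit`, row IK20-A; honest framing: bookkeeping of
Ikenmeyer–Kandasamy's toy model; VP ≠ VNP is NOT proved and nothing here is progress on it).

Ikenmeyer–Kandasamy 2020 (arXiv:1911.03990) §3 / §6 identify a tableau `T : λ → 𝒜` with a basis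
tensor of `⊗^{|λ|} ℂ^m` read along the boxes of `λ` (TeX L323: "A tableau of shape `λ` … is a
mapping `λ → 𝒜` of boxes"; §6, TeX L613–636: "`{λ} ≃ (⊗^{|λ|} ℂ^m)/K(λ)`"). The tree has BOTH ends:
the tensor-word model `(k^m)^{⊗n}` with its standard basis indexed by words `x : Fin n → Fin m`
(`TensorWordModel`, `tensorBasis`, the canonical row-major numbering of the boxes of `λ ⊢ n` by
`Fin n` through `Nat.Partition.rowOf` / `colOf`, `rowWord`, `rowStabilizer`, `colStabilizer`,
`youngSymmetrizer` — `SchurWeylPlethysm`, `SchurWeylHighestWeightProofs`), and the column-format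
tableaux `IK2020.ColTableau` of `IK20HighestWeightVectors.lean` on which `IK2020.gammaProd`,
`IK2020_thm_13_1` and `IK2020_thm_9_1_orbitFunctions` are stated. This file is the DICTIONARY:

* `IK2020.numCols λ = λ₁`, `IK2020.colHeight λ c = λᵗ_c` (through Mathlib's `YoungDiagram.rowLen` /
  `colLen` of `λ.youngDiagram`), `IK2020.colPos λ c r : Fin n` = the position of the box in column
  `c`, row `r` (`rowOf_colPos`, `colOf_colPos`), and the box bijection
  `IK2020.colPosEquiv λ : (Σ c, Fin (colHeight λ c)) ≃ Fin n`;
* `IK2020.wordTableau λ x : ColTableau α` — the word `x : Fin n → α` READ AS A TABLEAU OF SHAPE `λ`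
  (columns `c < λ₁` of heights `λᵗ_c`, entry of box `(c, r)` = `x (colPos λ c r)`), with its shape
  (`wordTableau_isShape`, `card_filter_lt_colHeight` — the row-length clause
  `#{c | r < h c} = λ_r` of `IK2020_thm_9_1_orbitFunctions`), content (`count_wordTableau`),
  regularity (`isRegular_wordTableau_iff` = no letter repeated inside a column) and relabelling
  (`wordTableau_relabel`: `π(T_x) = T_{π ∘ x}`) lemmas, and the link to the row word
  (`val_rowWord_colPos`: the letter of `rowWord λ` at the box `(c, r)` is `r`).

Consumers: the matrix-coefficient identity `γ(g T_x) · |R_λ| = ⟨e_{rowWord}, g · c_λ e_x⟩`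
(`IK2020GammaProdMatrixCoefficient.lean`, brick M1) and the extraction of the independent orbit
functions (`IK2020_thm_9_1_orbitFunctions_holds`, brick M4) of the cell's programme #4
(val-lit lead-bip RULINGS #12/#12a, 2026-08-27; architect's note
`HOME/bip/NOTE-t02g6-G-discharge-sizing.md`). Definitions only of the plumbing kind (no instances,
no notation); every lemma elementary. [folklore] around [IkenmeyerKandasamy2019, §3, §6];
Fulton, *Young Tableaux*, §7.1 (canonical numbering of boxes).

## References

* [IkenmeyerKandasamy2019] C. Ikenmeyer, U. Kandasamy, STOC 2020 = arXiv:1911.03990, §3 (tableaux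
  as maps `λ → 𝒜`, TeX L304–330), §6 (`{λ}` inside `⊗^{|λ|} ℂ^m`, TeX L613–636).
* W. Fulton, *Young Tableaux*, LMS Student Texts 35 (1997), §7.1, §8.1.
-/

noncomputable section

open scoped BigOperators

namespace Literature.Computability.AlgebraicComplexity

namespace IK2020

open Finset
open _root_.Literature.NumberTheory.DiophantineGeometry

variable {n : ℕ} (lam : Nat.Partition n)

/-! ### §1 Columns of the canonical tableau -/

/-- The number of columns `λ₁` of the shape `λ` (`0` for the empty partition). IK §3, TeX L309
("`λᵗ` … column lengths"); Fulton §7.1. [cite: IkenmeyerKandasamy2019, §3] -/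
def numCols : ℕ :=
  lam.youngDiagram.rowLen 0

/-- The height `λᵗ_c` of column `c < λ₁` (IK §3, TeX L309–310: "the transpose `λᵗ` … records
the column lengths"). [cite: IkenmeyerKandasamy2019, §3] -/
def colHeight (c : Fin (numCols lam)) : ℕ :=
  lam.youngDiagram.colLen c

/-- The row length `λ_r` of the Young diagram is the padded part `λ_r` (`0` below the last row).
[cite: IkenmeyerKandasamy2019, §3] -/
theorem rowLen_youngDiagram (r : ℕ) : lam.youngDiagram.rowLen r = lam.sortedParts.getD r 0 := by
  refine le_antisymm ?_ ?_
  · -- every box of row `r` has column `< λ_r`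
    by_contra h
    rw [not_le] at h
    have hmem : (r, lam.sortedParts.getD r 0) ∈ lam.youngDiagram :=
      YoungDiagram.mem_iff_lt_rowLen.mpr h
    obtain ⟨hr, hc⟩ := (lam.mem_youngDiagram_iff _).mp hmem
    rw [List.getD_eq_getElem _ _ hr] at hc
    exact lt_irrefl _ hc
  · rcases Nat.eq_zero_or_pos (lam.sortedParts.getD r 0) with h0 | hpos
    · rw [h0]; exact Nat.zero_le _
    · have hr : r < lam.sortedParts.length := by
        by_contra hr
        rw [List.getD_eq_default _ _ (not_lt.mp hr)] at hpos
        exact lt_irrefl _ hpos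
      have hmem : (r, lam.sortedParts.getD r 0 - 1) ∈ lam.youngDiagram := by
        rw [lam.mem_youngDiagram_iff]
        refine ⟨hr, ?_⟩
        rw [List.getD_eq_getElem _ _ hr] at hpos ⊢
        dsimp only
        omega
      have := YoungDiagram.mem_iff_lt_rowLen.mp hmem
      omega

/-- `λ₁ = λ.sortedParts.getD 0 0`. [cite: IkenmeyerKandasamy2019, §3] -/
theorem numCols_eq : numCols lam = lam.sortedParts.getD 0 0 :=
  rowLen_youngDiagram lam 0

/-- The box `(r, c)` of a column lies in the diagram. [cite: IkenmeyerKandasamy2019, §3] -/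
theorem mem_youngDiagram_colHeight (c : Fin (numCols lam)) (r : Fin (colHeight lam c)) :
    ((r : ℕ), (c : ℕ)) ∈ lam.youngDiagram :=
  YoungDiagram.mem_iff_lt_colLen.mpr r.2

/-- Columns are nonempty: `0 < λᵗ_c` for `c < λ₁`. [cite: IkenmeyerKandasamy2019, §3] -/
theorem colHeight_pos (c : Fin (numCols lam)) : 0 < colHeight lam c :=
  YoungDiagram.mem_iff_lt_colLen.mp (YoungDiagram.mem_iff_lt_rowLen.mpr c.2)

/-- Column heights are at most the number of rows `ℓ(λ)`. [cite: IkenmeyerKandasamy2019, §3] -/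
theorem colHeight_le_card (c : Fin (numCols lam)) : colHeight lam c ≤ lam.parts.card := by
  have h := lam.youngDiagram.colLen_anti 0 c (Nat.zero_le _)
  rw [← YoungDiagram.length_rowLens, lam.rowLens_youngDiagram, Nat.Partition.length_sortedParts] at h
  exact h

/-- Column heights are weakly decreasing. [cite: IkenmeyerKandasamy2019, §3] -/
theorem colHeight_antitone : Antitone (colHeight lam) :=
  fun c c' h => lam.youngDiagram.colLen_anti c c' h

/-- Every position lies in a column `< λ₁`. [cite: IkenmeyerKandasamy2019, §3] -/
theorem colOf_lt_numCols (p : Fin n) : lam.colOf p < numCols lam :=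
  lt_of_lt_of_le (YoungDiagram.mem_iff_lt_rowLen.mp (lam.rowOf_colOf_mem_youngDiagram p))
    (lam.youngDiagram.rowLen_anti 0 _ (Nat.zero_le _))

/-- Every position lies in a row below the height of its column. [cite: IkenmeyerKandasamy2019, §3] -/
theorem rowOf_lt_colHeight (p : Fin n) :
    lam.rowOf p < colHeight lam ⟨lam.colOf p, colOf_lt_numCols lam p⟩ :=
  rowOf_lt_colLen lam p

/-- **The position of the box in column `c`, row `r`** in the canonical row-major numbering of the
boxes of `λ` by `Fin n` (Fulton §7.1; the inverse of `p ↦ (rowOf p, colOf p)`).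
[cite: IkenmeyerKandasamy2019, §3] -/
def colPos (c : Fin (numCols lam)) (r : Fin (colHeight lam c)) : Fin n :=
  Classical.choose (exists_rowOf_eq_and_colOf_eq lam (mem_youngDiagram_colHeight lam c r))

/-- The box `colPos λ c r` lies in row `r`. [cite: IkenmeyerKandasamy2019, §3] -/
@[simp] theorem rowOf_colPos (c : Fin (numCols lam)) (r : Fin (colHeight lam c)) :
    lam.rowOf (colPos lam c r) = r :=
  (Classical.choose_spec (exists_rowOf_eq_and_colOf_eq lam (mem_youngDiagram_colHeight lam c r))).1

/-- The box `colPos λ c r` lies in column `c`. [cite: IkenmeyerKandasamy2019, §3] -/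
@[simp] theorem colOf_colPos (c : Fin (numCols lam)) (r : Fin (colHeight lam c)) :
    lam.colOf (colPos lam c r) = c :=
  (Classical.choose_spec (exists_rowOf_eq_and_colOf_eq lam (mem_youngDiagram_colHeight lam c r))).2

/-- **The box bijection** `(c, r) ↦ colPos λ c r : (Σ c < λ₁, Fin λᵗ_c) ≃ Fin n` (inverse
`p ↦ (colOf p, rowOf p)`). [cite: IkenmeyerKandasamy2019, §3] -/
def colPosEquiv : (Σ c : Fin (numCols lam), Fin (colHeight lam c)) ≃ Fin n where
  toFun b := colPos lam b.1 b.2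
  invFun p := ⟨⟨lam.colOf p, colOf_lt_numCols lam p⟩, ⟨lam.rowOf p, rowOf_lt_colHeight lam p⟩⟩
  left_inv b := by
    obtain ⟨c, r⟩ := b
    refine Sigma.ext (Fin.ext (colOf_colPos lam c r)) ((Fin.heq_ext_iff ?_).2 ?_)
    · dsimp only
      congr 1
      exact Fin.ext (colOf_colPos lam c r)
    · exact rowOf_colPos lam c r
  right_inv p := eq_of_rowOf_eq_of_colOf_eq lam (rowOf_colPos lam _ _) (colOf_colPos lam _ _)

/-- Unfolding lemma for the box bijection. [cite: IkenmeyerKandasamy2019, §3] -/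
@[simp] theorem colPosEquiv_apply (b : Σ c : Fin (numCols lam), Fin (colHeight lam c)) :
    colPosEquiv lam b = colPos lam b.1 b.2 :=
  rfl

/-- Unfolding lemma for the inverse box bijection (column component). [cite: IkenmeyerKandasamy2019, §3] -/
@[simp] theorem colPosEquiv_symm_apply_fst (p : Fin n) :
    (((colPosEquiv lam).symm p).1 : ℕ) = lam.colOf p :=
  rfl

/-- Unfolding lemma for the inverse box bijection (row component). [cite: IkenmeyerKandasamy2019, §3] -/
@[simp] theorem colPosEquiv_symm_apply_snd (p : Fin n) :
    (((colPosEquiv lam).symm p).2 : ℕ) = lam.rowOf p :=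
  rfl

/-- `colPos` is jointly injective. [cite: IkenmeyerKandasamy2019, §3] -/
theorem colPos_injective {c c' : Fin (numCols lam)} {r : Fin (colHeight lam c)}
    {r' : Fin (colHeight lam c')} (h : colPos lam c r = colPos lam c' r') :
    (⟨c, r⟩ : Σ c : Fin (numCols lam), Fin (colHeight lam c)) = ⟨c', r'⟩ :=
  (colPosEquiv lam).injective h

/-- `∑_c λᵗ_c = n`: the columns exhaust the boxes. [cite: IkenmeyerKandasamy2019, §3] -/
theorem sum_colHeight : ∑ c, colHeight lam c = n := by
  have h := Fintype.card_congr (colPosEquiv lam)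
  rw [Fintype.card_sigma, Fintype.card_fin] at h
  simpa only [Fintype.card_fin] using h

/-- **Row `r` meets exactly `λ_r` columns**: `#{c < λ₁ | r < λᵗ_c} = λ_r` (the row-length clause of
`IK2020_thm_9_1_orbitFunctions` for tableaux of shape `λ`). [cite: IkenmeyerKandasamy2019, §3] -/
theorem card_filter_lt_colHeight (r : ℕ) :
    (univ.filter fun c : Fin (numCols lam) => r < colHeight lam c).card =
      lam.sortedParts.getD r 0 := by
  rw [← rowLen_youngDiagram]
  have hset : (univ.filter fun c : Fin (numCols lam) => r < colHeight lam c) =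
      univ.filter fun c : Fin (numCols lam) => (c : ℕ) < lam.youngDiagram.rowLen r := by
    ext c
    simp only [mem_filter, mem_univ, true_and, colHeight, ← YoungDiagram.mem_iff_lt_colLen,
      YoungDiagram.mem_iff_lt_rowLen]
  rw [hset, Fin.card_filter_val_lt]
  exact min_eq_right (lam.youngDiagram.rowLen_anti 0 r (Nat.zero_le _))

/-! ### §2 Words read as tableaux of shape `λ` -/

/-- **The word `x` read as a tableau of shape `λ`** (IK §3, TeX L323: a tableau is a map from the
boxes of `λ` to the alphabet; here the boxes are numbered by `Fin n` row by row and the tableau is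
recorded column by column as an `IK2020.ColTableau`): `λ₁` columns of heights `λᵗ_c`, the entry of
box `(c, r)` being `x (colPos λ c r)`. [cite: IkenmeyerKandasamy2019, §3] -/
def wordTableau {α : Type*} (x : Fin n → α) : ColTableau α :=
  ⟨numCols lam, colHeight lam, fun c r => x (colPos lam c r)⟩

variable {α β : Type*}

/-- Unfolding lemmas for `wordTableau`. [cite: IkenmeyerKandasamy2019, §3] -/
@[simp] theorem wordTableau_C (x : Fin n → α) : (wordTableau lam x).C = numCols lam := rfl

/-- Unfolding lemma (heights). [cite: IkenmeyerKandasamy2019, §3] -/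
@[simp] theorem wordTableau_h (x : Fin n → α) : (wordTableau lam x).h = colHeight lam := rfl

/-- Unfolding lemma (entries). [cite: IkenmeyerKandasamy2019, §3] -/
@[simp] theorem wordTableau_entry (x : Fin n → α) (c : Fin (numCols lam)) (r : Fin (colHeight lam c)) :
    (wordTableau lam x).entry c r = x (colPos lam c r) := rfl

/-- **Relabelling a word relabels its tableau**: `φ(T_x) = T_{φ ∘ x}` (IK §7, TeX L662; for
`φ = π ∈ 𝔖_m` this is `πS`). [cite: IkenmeyerKandasamy2019, §7] -/
theorem wordTableau_relabel (φ : α → β) (x : Fin n → α) :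
    (wordTableau lam x).relabel φ = wordTableau lam (φ ∘ x) :=
  rfl

/-- **The tableau of a word has shape `λ ⊢_m n`** whenever `λ` has at most `m` rows.
[cite: IkenmeyerKandasamy2019, §3] -/
theorem wordTableau_isShape {m : ℕ} (hlam : lam.parts.card ≤ m) (x : Fin n → α) :
    (wordTableau lam x).IsShape m n :=
  ⟨colHeight_antitone lam, fun c => ⟨colHeight_pos lam c, (colHeight_le_card lam c).trans hlam⟩,
    sum_colHeight lam⟩

/-- The row-length clause for the tableau of a word: row `r` has `λ_r` boxes. [cite: IkenmeyerKandasamy2019, §3] -/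
theorem card_filter_lt_wordTableau_h (x : Fin n → α) (r : ℕ) :
    (univ.filter fun c : Fin (wordTableau lam x).C => r < (wordTableau lam x).h c).card =
      lam.sortedParts.getD r 0 :=
  card_filter_lt_colHeight lam r

/-- **Content**: the letter `a` occurs in `T_x` as often as in `x`. [cite: IkenmeyerKandasamy2019, §3] -/
theorem count_wordTableau [DecidableEq α] (x : Fin n → α) (a : α) :
    (wordTableau lam x).count a = (univ.filter fun p : Fin n => x p = a).card := by
  rw [← ColTableau.card_filter_box_eq_count]
  refine Finset.card_equiv (colPosEquiv lam) fun b => ?_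
  simp only [mem_filter, mem_univ, true_and, wordTableau_entry]
  exact Iff.rfl

/-- **Regularity**: `T_x` is regular (no letter twice in a column) iff `x` takes distinct values at
distinct positions of the same column. [cite: IkenmeyerKandasamy2019, §3] -/
theorem isRegular_wordTableau_iff (x : Fin n → α) :
    (wordTableau lam x).IsRegular ↔
      ∀ p q : Fin n, lam.colOf p = lam.colOf q → x p = x q → p = q := by
  constructor
  · intro h p q hc hx
    have hp := (colPosEquiv lam).apply_symm_apply p
    have hq := (colPosEquiv lam).apply_symm_apply q
    simp only [colPosEquiv_apply] at hp hq
    -- both positions sit in column `c = colOf p = colOf q`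
    set bp := (colPosEquiv lam).symm p with hbp
    set bq := (colPosEquiv lam).symm q with hbq
    have hc' : bp.1 = bq.1 := Fin.ext (by
      rw [hbp, hbq, colPosEquiv_symm_apply_fst, colPosEquiv_symm_apply_fst, hc])
    obtain ⟨cp, rp⟩ := bp
    obtain ⟨cq, rq⟩ := bq
    dsimp only at hc' hp hq
    subst hc'
    have hinj := h cp
    have : rp = rq := hinj (by simp only [wordTableau_entry, hp, hq, hx])
    rw [← hp, ← hq, this]
  · intro h c r r' hrr'
    simp only [wordTableau_entry] at hrr'
    have := h _ _ (by rw [colOf_colPos, colOf_colPos]) hrr'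
    have hs := colPos_injective lam this
    simp only [Sigma.mk.injEq, heq_eq_eq, true_and] at hs
    exact hs

/-- **The row word on the boxes**: the letter of `rowWord λ` at the box `(c, r)` is `r` (row `i`
of the canonical tableau is filled with the letter `i`; Fulton §8.2 Lemma 4).
[cite: FultonYoungTableaux1997, §8.2 Lemma 4] -/
@[simp] theorem val_rowWord_colPos {m : ℕ} (hlam : lam.parts.card ≤ m) (c : Fin (numCols lam))
    (r : Fin (colHeight lam c)) : (rowWord lam hlam (colPos lam c r) : ℕ) = r := by
  rw [rowWord_val, rowOf_colPos]

/-- The row word at a box, as an element of `Fin m`: `Fin.castLE` of the row index.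
[cite: IkenmeyerKandasamy2019, §3] -/
theorem rowWord_colPos {m : ℕ} (hlam : lam.parts.card ≤ m) (c : Fin (numCols lam))
    (r : Fin (colHeight lam c)) :
    rowWord lam hlam (colPos lam c r) = Fin.castLE ((colHeight_le_card lam c).trans hlam) r :=
  Fin.ext (val_rowWord_colPos lam hlam c r)

end IK2020

end Literature.Computability.AlgebraicComplexity

end
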